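import Literature.NumberTheory.Sieve.HeathBrownMorozClassFLBound
import Literature.NumberTheory.Sieve.HeathBrownMorozClassLevel
import Literature.NumberTheory.Sieve.HeathBrownCubicMertensK
import HarnessLib

/-!
# HBM Lemma 3.1 (the class Lemma 3.5), IV: the choice of parameters — `h35` discharged

Pure-proof file completing the residue-class ("coset") port of D. R. Heath-Brown, *Primes
represented by `x³ + 2y³`*, Acta Math. 186 (2001), Lemma 3.5 (§6), to the class
`x ≡ a, y ≡ b (mod d)` of Heath-Brown–Moroz, Proc. LMS 88 (2004), **Lemma 3.1**: for every
modulus `d ≥ 1`, every admissible class `(a, b)` (`a, b < d`, `(a³ + 2b³, d) = 1`), every `σ₀` with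
`∏_{p<w}(1 − (ν_p−1)/p) → σ₀`, and `0 < ϖ < 1/5`, `τ = (log log X)^{-ϖ}`, there are `C, X₀` with
`∑_{n ≤ n₀} |T^(n)(𝒜_f) − classKappa·T^(n)(ℬ)| ≤ C τη²X²/log X`
for `X ≥ X₀`, `exp(−(log X)^{1/3}) ≤ η ≤ 1` (`class_lemma_3_5`), where `classKappa = (w(d)/d²)κ` is
the comparison constant of [HBM, (3.1)].  This is exactly the hypothesis `h35` of
`Summit.Parity.GeneralizedHardyLittlewood.Theorems…heathBrownMorozUniform_of_classLemmas`.
The proof is `HeathBrown2001_lemma_3_5_of` word for word (`class_lemma_3_5_of`, with Mertens'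
theorem for `K` as a hypothesis, discharged by `mertensK_grouped`), the level input being
`class_level` and the threshold `T₁` enlarged by `d + 1` so that `z = X^τ > d`.
[cite: HeathBrownMoroz2004, Lemma 3.1] [cite: HeathBrownActa2001, Lemma 3.5 and §6]
Search: `lean search 'lemma_3_5_of|lemma_3_5_holds'` — the `d = 1` versions only.
-/

noncomputable section

open NumberField Finset Filter

open scoped Topology

namespace Literature.NumberTheory.Sieve.CubicSieve

open LFunctions.CubeRootTwoField CubicPrimes

set_option maxHeartbeats 1000000 in
open scoped Classical in
/-- **HBM Lemma 3.1 from Mertens' theorem for `K`** (class analogue of `HeathBrown2001_lemma_3_5_of`,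
with the class level of distribution `class_level` built in): for an admissible class, `σ₀` the
limit of Heath-Brown's singular product, `0 < ϖ < 1/5`, `τ = (log log X)^{-ϖ}`:
`∑_{n ≤ n₀} |T^(n)(𝒜_f) − classKappa·T^(n)(ℬ)| ≤ C τη²X²/log X` for `X ≥ X₀`,
`exp(−(log X)^{1/3}) ≤ η ≤ 1`. [cite: HeathBrownMoroz2004, Lemma 3.1]
[cite: HeathBrownActa2001, Lemma 3.5 and §6] -/
theorem class_lemma_3_5_of
    (hmer : ∃ C z₀ : ℝ, ∀ z : ℝ, z₀ ≤ z →
      |(∏ p ∈ Nat.primesBelow ⌈z⌉₊, (1 - normDensityAt p)) *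
          (Real.exp Real.eulerMascheroniConstant * gamma₀ * Real.log z) - 1| ≤ C / Real.log z)
    {d a b : ℕ} (hd : 0 < d) (ha : a < d) (hb : b < d) (hadm : Nat.Coprime (a ^ 3 + 2 * b ^ 3) d)
    (σ₀ : ℝ) (hσ : Tendsto singularProductPartial atTop (𝓝 σ₀)) (ϖ : ℝ) (hϖ0 : 0 < ϖ)
    (hϖ5 : ϖ < 1 / 5) :
    ∃ C X₀ : ℝ, ∀ X η : ℝ, X₀ ≤ X → Real.exp (-Real.log X ^ (1 / 3 : ℝ)) ≤ η → η ≤ 1 →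
      ∑ n ∈ range (chainBound (hbTau ϖ X) + 1),
          |(Tpiece (classPairs X η d a b) pairIdeal X (hbTau ϖ X) n : ℝ) -
            classKappa σ₀ X η d * Tpiece (normWindow X η) (fun J => J) X (hbTau ϖ X) n| ≤
        C * hbTau ϖ X * η ^ 2 * X ^ 2 / Real.log X := by
  have hϖ1 : ϖ ≤ 1 := by linarith
  -- the constants
  obtain ⟨hσ₀, C₇, z₇, hC7, h7⟩ := exists_abs_prodA_sub_le hσ
  obtain ⟨C₉, z₉, hC9, h9⟩ := exists_abs_prodB_sub_le_of hmer
  obtain ⟨C_A, hCA, hFLA⟩ := exists_FLBound dimConst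
  obtain ⟨C_FL, hCFL, hFLB⟩ := exists_FLBound (Real.exp (3 * (9 / 2 + 6 / Real.log 2) + 3))
  obtain ⟨C_W, hCW, hW⟩ := exists_windowDvdCount_sub_le
  obtain ⟨C_B, hCB, hB⟩ := exists_countB_le
  obtain ⟨C₁, hC1, hW1⟩ := exists_smallPrimesWeight_le
  obtain ⟨C_PA, z_PA, hCPA, hPA⟩ := exists_prodA_le hσ
  obtain ⟨K_V, hKV0, hKV⟩ := exists_prod_one_sub_normDensityAt_le
  obtain ⟨θ, hθ, C_L, X_L, hL⟩ := class_level hd ha hb hadm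
  set δ := 2 - θ with hδ
  have hδ0 : 0 < δ := by rw [hδ]; linarith
  set C_L' := max C_L 1 with hCL'
  have hCL'1 : 1 ≤ C_L' := le_max_right _ _
  have hCL'0 : 0 < C_L' := by linarith
  -- thresholds on `L = log X`
  set A₄ := 14 * Real.exp 3 * (C₇ + σ₀ * C₉) with hA₄
  set A₅ := 1904 * σ₀ * Real.exp 3 with hA₅
  set A₆ := 3 * σ₀ * Real.exp 3 * C_B with hA₆
  set A₇ := 2 * σ₀ * Real.exp 35 * C_W with hA₇
  have hA₄0 : 0 ≤ A₄ := by positivity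
  have hA₅0 : 0 ≤ A₅ := by positivity
  have hA₆0 : 0 ≤ A₆ := by positivity
  have hA₇0 : 0 ≤ A₇ := by positivity
  set ℓ₀ := max 1 (max ((1 / 4 : ℝ) ^ (-(1 / ϖ))) ((((4 : ℝ) ^ 6 * 720)⁻¹) ^ (-(1 / ϖ)))) with hℓ₀
  set T₁ := max ((2 : ℝ) ^ 10) (max z₇ (max z₉ (max z_PA (max (2 * C₁) ((d : ℝ) + 1))))) with hT₁
  have hT₁0 : 0 ≤ T₁ := le_trans (by norm_num) (le_max_left _ _)
  set L₀ := max (Real.exp ℓ₀) (max (4 * T₁ ^ 2) (max ((4096 * A₄) ^ 2) (max (36 * (2 * (24576 * A₅)) ^ 2)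
    (max (64 * (120 * (16384 * A₆)) ^ 2) (max ((8 : ℝ) ^ 6) (max (4 * ((Nat.factorial 11 : ℝ) * (4 ^ 11 * A₇)))
    (max ((4 / δ) ^ (3 / 2 : ℝ)) (2 * (6 * (8 * C_L' / δ ^ 2)) / δ)))))))) with hL₀
  refine ⟨classWeight d / (d : ℝ) ^ 2 *
      (C_A * C_PA * Real.exp 3 + σ₀ * Real.exp 3 * C_FL * gamma₀ * K_V + 4) + 1,
    max X_L (Real.exp L₀), fun X η hX hηlo hη1 => ?_⟩
  -- unpack the thresholds
  have hXL : X_L ≤ X := le_trans (le_max_left _ _) hX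
  have hXe : Real.exp L₀ ≤ X := le_trans (le_max_right _ _) hX
  set L := Real.log X with hLdef
  have hLL₀ : L₀ ≤ L := by
    rw [hLdef, ← Real.log_exp L₀]; exact Real.log_le_log (Real.exp_pos _) hXe
  have hL_ℓ₀ : Real.exp ℓ₀ ≤ L := le_trans (le_max_left _ _) hLL₀
  have hL_T₁ : 4 * T₁ ^ 2 ≤ L := le_trans (le_trans (le_max_left _ _) (le_max_right _ _)) hLL₀
  have hL_A₄ : (4096 * A₄) ^ 2 ≤ L :=
    le_trans (le_trans (le_trans (le_max_left _ _) (le_max_right _ _)) (le_max_right _ _)) hLL₀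
  have hL_A₅ : 36 * (2 * (24576 * A₅)) ^ 2 ≤ L :=
    le_trans (le_trans (le_trans (le_trans (le_max_left _ _) (le_max_right _ _)) (le_max_right _ _)) (le_max_right _ _)) hLL₀
  have hL_A₆ : 64 * (120 * (16384 * A₆)) ^ 2 ≤ L :=
    le_trans (le_trans (le_trans (le_trans (le_trans (le_max_left _ _) (le_max_right _ _)) (le_max_right _ _))
      (le_max_right _ _)) (le_max_right _ _)) hLL₀
  have hL_86 : (8 : ℝ) ^ 6 ≤ L :=
    le_trans (le_trans (le_trans (le_trans (le_trans (le_trans (le_max_left _ _) (le_max_right _ _)) (le_max_right _ _))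
      (le_max_right _ _)) (le_max_right _ _)) (le_max_right _ _)) hLL₀
  have hL_A₇ : 4 * ((Nat.factorial 11 : ℝ) * (4 ^ 11 * A₇)) ≤ L :=
    le_trans (le_trans (le_trans (le_trans (le_trans (le_trans (le_trans (le_max_left _ _) (le_max_right _ _))
      (le_max_right _ _)) (le_max_right _ _)) (le_max_right _ _)) (le_max_right _ _)) (le_max_right _ _)) hLL₀
  have hL_δ : (4 / δ) ^ (3 / 2 : ℝ) ≤ L :=
    le_trans (le_trans (le_trans (le_trans (le_trans (le_trans (le_trans (le_trans (le_max_left _ _) (le_max_right _ _))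
      (le_max_right _ _)) (le_max_right _ _)) (le_max_right _ _)) (le_max_right _ _)) (le_max_right _ _))
      (le_max_right _ _)) hLL₀
  have hL_CL : 2 * (6 * (8 * C_L' / δ ^ 2)) / δ ≤ L :=
    le_trans (le_trans (le_trans (le_trans (le_trans (le_trans (le_trans (le_trans (le_max_right _ _) (le_max_right _ _))
      (le_max_right _ _)) (le_max_right _ _)) (le_max_right _ _)) (le_max_right _ _)) (le_max_right _ _))
      (le_max_right _ _)) hLL₀
  -- basic sizes
  have hL86 : (262144 : ℝ) ≤ L := by norm_num at hL_86; exact hL_86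
  have hL1 : 1 ≤ L := by linarith
  have hL0 : 0 < L := by linarith
  have hX0 : 0 < X := lt_of_lt_of_le (Real.exp_pos _) hXe
  have hXexp : X = Real.exp L := by rw [hLdef, Real.exp_log hX0]
  have hX3 : 3 ≤ X := by
    rw [hXexp]
    have := Real.add_one_le_exp L
    linarith
  set ℓ := Real.log L with hℓdef
  have hℓ_ℓ₀ : ℓ₀ ≤ ℓ := by
    rw [hℓdef, ← Real.log_exp ℓ₀]; exact Real.log_le_log (Real.exp_pos _) hL_ℓ₀
  have hℓ1 : 1 ≤ ℓ := le_trans (le_max_left _ _) hℓ_ℓ₀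
  have hℓ0 : 0 < ℓ := by linarith
  have hτdef : hbTau ϖ X = ℓ ^ (-ϖ) := rfl
  set τ := hbTau ϖ X with hτ
  obtain ⟨hτ0, hτ1, hℓτ⟩ := hbTau_bounds (X := X) hϖ0 hϖ1 hℓ1
  rw [← hτ] at hτ0 hτ1 hℓτ
  have hτ4 : τ ≤ 1 / 4 := by
    rw [hτ]; exact hbTau_le_of hϖ0 (by norm_num) (le_trans (le_trans (le_max_left _ _) (le_max_right _ _)) hℓ_ℓ₀)
  have hτsmall : τ ≤ ((4 : ℝ) ^ 6 * 720)⁻¹ := by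
    rw [hτ]; exact hbTau_le_of hϖ0 (by norm_num) (le_trans (le_trans (le_max_right _ _) (le_max_right _ _)) hℓ_ℓ₀)
  have hτinv : τ⁻¹ ≤ ℓ := by
    have := inv_anti₀ (inv_pos.mpr hℓ0) hℓτ
    rwa [inv_inv] at this
  obtain ⟨hℓsqrt, hℓ8⟩ := log_le_sqrt_and hL0.le
  rw [← hℓdef] at hℓsqrt hℓ8
  have hsqrtL0 : 0 < Real.sqrt L := Real.sqrt_pos.mpr hL0
  have hsqL : Real.sqrt L * Real.sqrt L = L := Real.mul_self_sqrt hL0.le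
  -- `τ L ≥ √L/2`
  have hτL : Real.sqrt L / 2 ≤ τ * L := by
    have h1 : L / ℓ ≤ τ * L := by
      rw [div_le_iff₀ hℓ0]
      calc L = ℓ⁻¹ * (L * ℓ) := by field_simp
        _ ≤ τ * (L * ℓ) := mul_le_mul_of_nonneg_right hℓτ (by positivity)
        _ = τ * L * ℓ := by ring
    have h2 : Real.sqrt L / 2 ≤ L / ℓ := by
      rw [div_le_div_iff₀ (by norm_num) hℓ0]
      calc Real.sqrt L * ℓ ≤ Real.sqrt L * (2 * Real.sqrt L) := mul_le_mul_of_nonneg_left hℓsqrt hsqrtL0.le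
        _ = L * 2 := by rw [mul_left_comm, hsqL, mul_comm]
    linarith only [h1, h2]
  have hT₁L : T₁ ≤ Real.sqrt L / 2 := by
    have : Real.sqrt (4 * T₁ ^ 2) ≤ Real.sqrt L := Real.sqrt_le_sqrt hL_T₁
    rw [show (4 : ℝ) * T₁ ^ 2 = (2 * T₁) ^ 2 by ring, Real.sqrt_sq (by positivity)] at this
    linarith
  -- `z = X^τ = e^{τL}`
  have hzexp : X ^ τ = Real.exp (τ * L) := by rw [Real.rpow_def_of_pos hX0, ← hLdef, mul_comm]
  have hzge : Real.sqrt L / 2 ≤ X ^ τ := by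
    rw [hzexp]; linarith [Real.add_one_le_exp (τ * L)]
  have hz10 : (2 : ℝ) ^ 10 ≤ X ^ τ := le_trans (le_trans (le_max_left _ _) hT₁L) hzge
  have hz7 : z₇ ≤ X ^ τ := le_trans (le_trans (le_trans (le_max_left _ _) (le_max_right _ _)) hT₁L) hzge
  have hz9 : z₉ ≤ X ^ τ :=
    le_trans (le_trans (le_trans (le_trans (le_max_left _ _) (le_max_right _ _)) (le_max_right _ _)) hT₁L) hzge
  have hzPA : z_PA ≤ X ^ τ :=
    le_trans (le_trans (le_trans (le_trans (le_trans (le_max_left _ _) (le_max_right _ _)) (le_max_right _ _))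
      (le_max_right _ _)) hT₁L) hzge
  have hT₁5 : max (2 * C₁) ((d : ℝ) + 1) ≤ T₁ :=
    le_trans (le_trans (le_trans (le_max_right _ _) (le_max_right _ _)) (le_max_right _ _))
      (le_max_right _ _)
  have hC1' : 2 * C₁ ≤ τ * L := le_trans (le_trans (le_trans (le_max_left _ _) hT₁5) hT₁L) hτL
  have hdz : (d : ℝ) < X ^ τ := by
    have := le_trans (le_trans (le_trans (le_max_right _ _) hT₁5) hT₁L) hzge
    linarith
  have hz16 : (16 : ℝ) ≤ X ^ τ := le_trans (by norm_num) hz10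
  -- (E3)
  have hE3 : Real.exp (-(1 / (4 * τ))) ≤ τ ^ 5 := by
    refine exp_neg_inv_le_pow_five hτ0 ?_
    have := inv_anti₀ hτ0 hτsmall
    rwa [inv_inv] at this
  -- `τ⁻⁴ ≤ ℓ⁴ ≤ 4096 √L` and `τ⁻² ≤ ℓ² ≤ 4L`, `τ⁻¹ ≤ 2L`
  have hℓ4 : ℓ ^ 4 ≤ 4096 * Real.sqrt L := by
    have h1 : ℓ ^ 4 ≤ (8 * L ^ (1 / 8 : ℝ)) ^ 4 := pow_le_pow_left₀ hℓ0.le hℓ8 4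
    have h2 : (L ^ (1 / 8 : ℝ)) ^ 4 = Real.sqrt L := by
      rw [← Real.rpow_natCast, ← Real.rpow_mul hL0.le, Real.sqrt_eq_rpow]; norm_num
    calc ℓ ^ 4 ≤ (8 * L ^ (1 / 8 : ℝ)) ^ 4 := h1
      _ = 4096 * Real.sqrt L := by rw [mul_pow, h2]; norm_num
  have hτ4inv : 1 ≤ τ ^ 4 * ℓ ^ 4 := by
    have h := pow_le_pow_left₀ (inv_pos.mpr hℓ0).le hℓτ 4
    rw [inv_pow] at h
    have := mul_le_mul_of_nonneg_right h (pow_nonneg hℓ0.le 4)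
    rwa [inv_mul_cancel₀ (pow_ne_zero 4 hℓ0.ne')] at this
  have hτ2inv : 1 ≤ τ ^ 2 * ℓ ^ 2 := by
    have h := pow_le_pow_left₀ (inv_pos.mpr hℓ0).le hℓτ 2
    rw [inv_pow] at h
    have := mul_le_mul_of_nonneg_right h (pow_nonneg hℓ0.le 2)
    rwa [inv_mul_cancel₀ (pow_ne_zero 2 hℓ0.ne')] at this
  have hℓ2 : ℓ ^ 2 ≤ 4 * L := by
    calc ℓ ^ 2 ≤ (2 * Real.sqrt L) ^ 2 := pow_le_pow_left₀ hℓ0.le hℓsqrt 2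
      _ = 4 * L := by rw [mul_pow, Real.sq_sqrt hL0.le]; norm_num
  have hsqrtLL : Real.sqrt L ≤ L := Real.sqrt_le_iff.mpr ⟨hL0.le, by nlinarith only [hL1]⟩
  have hℓL : ℓ ≤ 2 * L := by linarith only [hℓsqrt, hsqrtLL]
  -- (E4): `A₄ ≤ τ⁴ L`
  have hE4 : A₄ ≤ τ ^ 4 * L := by
    have hsq : 4096 * A₄ ≤ Real.sqrt L := by
      have := Real.sqrt_le_sqrt hL_A₄
      rwa [Real.sqrt_sq (by positivity)] at this
    -- `τ⁴ L ≥ L/ℓ⁴ ≥ L/(4096√L) = √L/4096 ≥ A₄`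
    have h2 : 1 ≤ τ ^ 4 * (4096 * Real.sqrt L) :=
      hτ4inv.trans (mul_le_mul_of_nonneg_left hℓ4 (pow_nonneg hτ0.le 4))
    have h1 : Real.sqrt L ≤ 4096 * (τ ^ 4 * L) := by
      calc Real.sqrt L = 1 * Real.sqrt L := (one_mul _).symm
        _ ≤ τ ^ 4 * (4096 * Real.sqrt L) * Real.sqrt L := mul_le_mul_of_nonneg_right h2 hsqrtL0.le
        _ = 4096 * (τ ^ 4 * L) := by
            rw [show τ ^ 4 * (4096 * Real.sqrt L) * Real.sqrt L = 4096 * τ ^ 4 * (Real.sqrt L * Real.sqrt L) by ring,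
              hsqL]; ring
    linarith only [hsq, h1]
  -- (E5): `A₅ ≤ τ⁴ z^{1/3}`
  have hE5 : A₅ ≤ τ ^ 4 * (X ^ τ) ^ (1 / 3 : ℝ) := by
    have hz13 : (X ^ τ) ^ (1 / 3 : ℝ) = Real.exp (τ * L / 3) := by
      rw [hzexp, ← Real.exp_mul]; ring_nf
    rw [hz13]
    set y := Real.sqrt L / 6 with hy
    have hy0 : 0 ≤ y := by positivity
    have hyexp : Real.exp y ≤ Real.exp (τ * L / 3) := Real.exp_le_exp.mpr (by rw [hy]; linarith)
    have hyA : ((1 + 1).factorial : ℝ) * (24576 * A₅) ≤ y := by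
      rw [hy, le_div_iff₀ (by norm_num)]
      have := Real.sqrt_le_sqrt hL_A₅
      rw [show (36 : ℝ) * (2 * (24576 * A₅)) ^ 2 = (6 * (2 * (24576 * A₅))) ^ 2 by ring,
        Real.sqrt_sq (by positivity)] at this
      norm_num [Nat.factorial]
      linarith
    have hkey := mul_pow_le_exp_of_le hy0 hyA
    rw [pow_one] at hkey
    -- `A₅ · 4096√L = 24576 A₅ y ≤ e^y ≤ e^{τL/3}` and `1 ≤ τ⁴ ℓ⁴ ≤ τ⁴ 4096 √L`
    have h1 : A₅ * (4096 * Real.sqrt L) ≤ Real.exp (τ * L / 3) := by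
      rw [show A₅ * (4096 * Real.sqrt L) = 24576 * A₅ * y by rw [hy]; ring]; exact hkey.trans hyexp
    have h2 : 1 ≤ τ ^ 4 * (4096 * Real.sqrt L) :=
      hτ4inv.trans (mul_le_mul_of_nonneg_left hℓ4 (pow_nonneg hτ0.le 4))
    calc A₅ = A₅ * 1 := (mul_one _).symm
      _ ≤ A₅ * (τ ^ 4 * (4096 * Real.sqrt L)) := mul_le_mul_of_nonneg_left h2 hA₅0
      _ = τ ^ 4 * (A₅ * (4096 * Real.sqrt L)) := by ring
      _ ≤ τ ^ 4 * Real.exp (τ * L / 3) := mul_le_mul_of_nonneg_left h1 (pow_nonneg hτ0.le 4)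
  -- (E6): `A₆ L ≤ τ² √z e^{-L^{1/3}}`
  obtain ⟨h13a, h13b⟩ := rpow_third_le hL_86
  have hE6 : A₆ * L ≤ τ ^ 2 * Real.sqrt (X ^ τ) * Real.exp (-L ^ (1 / 3 : ℝ)) := by
    have hsz : Real.sqrt (X ^ τ) = Real.exp (τ * L / 2) := by rw [hzexp, sqrt_exp]
    rw [hsz]
    set y := Real.sqrt L / 8 with hy
    have hy0 : 0 ≤ y := by positivity
    -- `e^{τL/2 − L^{1/3}} ≥ e^{√L/4 − √L/8} = e^{y}`
    have hexp : Real.exp y ≤ Real.exp (τ * L / 2) * Real.exp (-L ^ (1 / 3 : ℝ)) := by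
      rw [← Real.exp_add]; refine Real.exp_le_exp.mpr ?_; rw [hy]; linarith
    have hyA : ((4 + 1).factorial : ℝ) * (16384 * A₆) ≤ y := by
      rw [hy, le_div_iff₀ (by norm_num)]
      have := Real.sqrt_le_sqrt hL_A₆
      rw [show (64 : ℝ) * (120 * (16384 * A₆)) ^ 2 = (8 * (120 * (16384 * A₆))) ^ 2 by ring,
        Real.sqrt_sq (by positivity)] at this
      norm_num [Nat.factorial]
      linarith
    have hkey := mul_pow_le_exp_of_le hy0 hyA
    -- `4 A₆ L² = 16384 A₆ y⁴ ≤ e^y` (`L = 64 y²`)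
    have hLy : L = 64 * y ^ 2 := by rw [hy, div_pow, Real.sq_sqrt hL0.le]; ring
    have h1 : 4 * A₆ * L ^ 2 ≤ Real.exp (τ * L / 2) * Real.exp (-L ^ (1 / 3 : ℝ)) := by
      calc 4 * A₆ * L ^ 2 = 16384 * A₆ * y ^ 4 := by rw [hLy]; ring
        _ ≤ Real.exp y := hkey
        _ ≤ _ := hexp
    -- `1 ≤ τ² ℓ² ≤ 4 τ² L`
    have h2 : 1 ≤ 4 * τ ^ 2 * L := by
      calc (1 : ℝ) ≤ τ ^ 2 * ℓ ^ 2 := hτ2inv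
        _ ≤ τ ^ 2 * (4 * L) := mul_le_mul_of_nonneg_left hℓ2 (pow_nonneg hτ0.le 2)
        _ = 4 * τ ^ 2 * L := by ring
    calc A₆ * L = A₆ * L * 1 := (mul_one _).symm
      _ ≤ A₆ * L * (4 * τ ^ 2 * L) := mul_le_mul_of_nonneg_left h2 (by positivity)
      _ = τ ^ 2 * (4 * A₆ * L ^ 2) := by ring
      _ ≤ τ ^ 2 * (Real.exp (τ * L / 2) * Real.exp (-L ^ (1 / 3 : ℝ))) := mul_le_mul_of_nonneg_left h1 (pow_nonneg hτ0.le 2)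
      _ = _ := by ring
  -- (E7): `A₇ L⁹ ≤ τ² √X e^{-L^{1/3}}`
  have hE7 : A₇ * L ^ 9 ≤ τ ^ 2 * Real.sqrt X * Real.exp (-L ^ (1 / 3 : ℝ)) := by
    have hsX : Real.sqrt X = Real.exp (L / 2) := by rw [hXexp, sqrt_exp]
    rw [hsX]
    set y := L / 4 with hy
    have hy0 : 0 ≤ y := by positivity
    have hexp : Real.exp y ≤ Real.exp (L / 2) * Real.exp (-L ^ (1 / 3 : ℝ)) := by
      rw [← Real.exp_add]; refine Real.exp_le_exp.mpr ?_; rw [hy]; linarith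
    have hyA : ((10 + 1).factorial : ℝ) * (4 ^ 11 * A₇) ≤ y := by
      rw [hy, le_div_iff₀ (by norm_num)]
      linarith
    have hkey := mul_pow_le_exp_of_le hy0 hyA
    have h1 : 4 * A₇ * L ^ 10 ≤ Real.exp (L / 2) * Real.exp (-L ^ (1 / 3 : ℝ)) := by
      calc 4 * A₇ * L ^ 10 = 4 ^ 11 * A₇ * y ^ 10 := by rw [hy]; ring
        _ ≤ Real.exp y := hkey
        _ ≤ _ := hexp
    have h2 : 1 ≤ 4 * τ ^ 2 * L := by
      calc (1 : ℝ) ≤ τ ^ 2 * ℓ ^ 2 := hτ2inv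
        _ ≤ τ ^ 2 * (4 * L) := mul_le_mul_of_nonneg_left hℓ2 (pow_nonneg hτ0.le 2)
        _ = 4 * τ ^ 2 * L := by ring
    calc A₇ * L ^ 9 = A₇ * L ^ 9 * 1 := (mul_one _).symm
      _ ≤ A₇ * L ^ 9 * (4 * τ ^ 2 * L) := mul_le_mul_of_nonneg_left h2 (by positivity)
      _ = τ ^ 2 * (4 * A₇ * L ^ 10) := by ring
      _ ≤ τ ^ 2 * (Real.exp (L / 2) * Real.exp (-L ^ (1 / 3 : ℝ))) := mul_le_mul_of_nonneg_left h1 (pow_nonneg hτ0.le 2)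
      _ = _ := by ring
  -- (E8): `C_L L e^{2L^{1/3}} X^θ ≤ τ X²`
  have hE8 : C_L * L * Real.exp (2 * L ^ (1 / 3 : ℝ)) * X ^ θ ≤ τ * X ^ 2 := by
    have hXθ : X ^ θ = Real.exp (θ * L) := by rw [Real.rpow_def_of_pos hX0, ← hLdef, mul_comm]
    have hX2 : X ^ 2 = Real.exp (2 * L) := by rw [hXexp, ← Real.exp_nat_mul]; norm_num
    rw [hXθ, hX2]
    -- `2L^{1/3} ≤ δL/2`
    have h13δ : 2 * L ^ (1 / 3 : ℝ) ≤ δ * L / 2 := by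
      have h23 : 4 / δ ≤ L ^ (2 / 3 : ℝ) := by
        calc 4 / δ = ((4 / δ) ^ (3 / 2 : ℝ)) ^ (2 / 3 : ℝ) := by
              rw [← Real.rpow_mul (by positivity)]; norm_num
          _ ≤ L ^ (2 / 3 : ℝ) := Real.rpow_le_rpow (by positivity) hL_δ (by norm_num)
      have hL' : L = L ^ (1 / 3 : ℝ) * L ^ (2 / 3 : ℝ) := by rw [← Real.rpow_add hL0]; norm_num
      have h13 : 0 < L ^ (1 / 3 : ℝ) := Real.rpow_pos_of_pos hL0 _
      have : 4 / δ * L ^ (1 / 3 : ℝ) ≤ L := by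
        calc 4 / δ * L ^ (1 / 3 : ℝ) ≤ L ^ (2 / 3 : ℝ) * L ^ (1 / 3 : ℝ) := mul_le_mul_of_nonneg_right h23 h13.le
          _ = L := by rw [mul_comm, ← hL']
      rw [div_mul_eq_mul_div, div_le_iff₀ hδ0] at this
      linarith
    set y := δ * L / 2 with hy
    have hy0 : 0 ≤ y := by positivity
    have hyA : ((2 + 1).factorial : ℝ) * (8 * C_L' / δ ^ 2) ≤ y := by
      rw [hy, le_div_iff₀ (by norm_num)]
      rw [div_le_iff₀ hδ0] at hL_CL
      norm_num [Nat.factorial]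
      linarith only [hL_CL]
    have hkey := mul_pow_le_exp_of_le hy0 hyA
    -- `2 C_L' L² = (8C_L'/δ²) y² ≤ e^y`
    have h1 : 2 * C_L' * L ^ 2 ≤ Real.exp y := by
      calc 2 * C_L' * L ^ 2 = 8 * C_L' / δ ^ 2 * y ^ 2 := by rw [hy]; field_simp; ring
        _ ≤ Real.exp y := hkey
    -- assemble: `C_L L e^{2L^{1/3}} e^{θL} ≤ C_L' L e^{y} e^{θL}` and `τ e^{2L} ≥ e^{2L}/(2L)`
    have hCL : C_L ≤ C_L' := le_max_left _ _
    have hτℓ : 1 ≤ τ * ℓ := by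
      have := mul_le_mul_of_nonneg_left hℓτ hℓ0.le
      rw [mul_inv_cancel₀ hℓ0.ne'] at this
      linarith only [this]
    have hτL2 : 1 ≤ 2 * τ * L := by
      calc (1 : ℝ) ≤ τ * ℓ := hτℓ
        _ ≤ τ * (2 * L) := mul_le_mul_of_nonneg_left hℓL hτ0.le
        _ = 2 * τ * L := by ring
    have hexp2 : Real.exp (2 * L) = Real.exp y * Real.exp y * Real.exp (θ * L) := by
      rw [← Real.exp_add, ← Real.exp_add]; congr 1; rw [hy, hδ]; ring
    have hEθ : 0 < Real.exp (θ * L) := Real.exp_pos _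
    have hEy : 0 < Real.exp y := Real.exp_pos _
    calc C_L * L * Real.exp (2 * L ^ (1 / 3 : ℝ)) * Real.exp (θ * L)
        ≤ C_L' * L * Real.exp y * Real.exp (θ * L) := by
          have : Real.exp (2 * L ^ (1 / 3 : ℝ)) ≤ Real.exp y := Real.exp_le_exp.mpr h13δ
          gcongr
      _ = (C_L' * L) * (Real.exp y * Real.exp (θ * L)) := by ring
      _ ≤ (τ * Real.exp y) * (Real.exp y * Real.exp (θ * L)) := by
          refine mul_le_mul_of_nonneg_right ?_ (by positivity)
          -- `C_L' L ≤ τ e^y` from `2C_L'L² ≤ e^y` and `1 ≤ 2τL`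
          calc C_L' * L = C_L' * L * 1 := (mul_one _).symm
            _ ≤ C_L' * L * (2 * τ * L) := mul_le_mul_of_nonneg_left hτL2 (by positivity)
            _ = τ * (2 * C_L' * L ^ 2) := by ring
            _ ≤ τ * Real.exp y := mul_le_mul_of_nonneg_left h1 hτ0.le
      _ = τ * Real.exp (2 * L) := by rw [hexp2]; ring
  -- conclude
  have hLEV := hL X η hXL hηlo hη1
  exact class_lemma_3_5_bound_of_params hσ₀ hFLA hCA.le hFLB hCFL.le hasSieveDimension_normDensity hW
    hCW hB hCB.le hC7 h7 hC9 h9 hCPA hPA (fun z hz => hKV z hz) hW1 hd a b hLEV hX3 hτ0 hτ4 hdz hηlo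
    hη1 hz16 hz7 hz9 hzPA hz10 hC1' hE3 hE4 hE5 hE6 hE7 hE8 _

/-- **Heath-Brown–Moroz 2004, Lemma 3.1 (the class Lemma 3.5), proved** — the hypothesis `h35` of
`heathBrownMorozUniform_of_classLemmas`: for `d ≥ 1`, `a, b < d`, `(a³ + 2b³, d) = 1`, every `σ₀`
with `singularProductPartial → σ₀` and `0 < ϖ < 1/5` there are `C, X₀` with
`∑_{n ≤ n₀} |T^(n)(𝒜_f) − classKappa σ₀ X η d · T^(n)(ℬ)| ≤ C τη²X²/log X` (`τ = (log log X)^{-ϖ}`)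
for `X ≥ X₀`, `exp(−(log X)^{1/3}) ≤ η ≤ 1`. [cite: HeathBrownMoroz2004, Lemma 3.1]
[cite: HeathBrownActa2001, Lemma 3.5] -/
theorem class_lemma_3_5 {d a b : ℕ} (hd : 0 < d) (ha : a < d) (hb : b < d)
    (hadm : Nat.Coprime (a ^ 3 + 2 * b ^ 3) d) (σ₀ : ℝ)
    (hσ : Tendsto singularProductPartial atTop (𝓝 σ₀)) (ϖ : ℝ) (hϖ0 : 0 < ϖ) (hϖ5 : ϖ < 1 / 5) :
    ∃ C X₀ : ℝ, ∀ X η : ℝ, X₀ ≤ X → Real.exp (-Real.log X ^ (1 / 3 : ℝ)) ≤ η → η ≤ 1 →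
      ∑ n ∈ range (chainBound (hbTau ϖ X) + 1),
          |(Tpiece (classPairs X η d a b) pairIdeal X (hbTau ϖ X) n : ℝ) -
            classKappa σ₀ X η d * Tpiece (normWindow X η) (fun J => J) X (hbTau ϖ X) n| ≤
        C * hbTau ϖ X * η ^ 2 * X ^ 2 / Real.log X :=
  class_lemma_3_5_of mertensK_grouped hd ha hb hadm σ₀ hσ ϖ hϖ0 hϖ5

end Literature.NumberTheory.Sieve.CubicSieve

end
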